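import Literature.Analysis.SpecialFunctions.BesselJZeroFermiIntegral
import Literature.Analysis.FunctionSpaces.LiebWuIntegralsProofs
import Literature.Analysis.FunctionSpaces.LiebWuIntegralsGapZeroProofs
import Literature.Analysis.FunctionSpaces.LiebWuChargeGapProofs
import Literature.Analysis.FunctionSpaces.BesselJWeberSchafheitlin
import HarnessLib

/-!
# Lieb–Wu 1968, eq. (23): the alternating series for the chemical potential `μ₋` of the
# half-filled Hubbard chain, and `lim_{U → 0} μ_± = 0`

E. H. Lieb, F. Y. Wu, *Absence of Mott transition in an exact solution of the short-range, one-band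
model in one dimension*, Phys. Rev. Lett. **20** (1968) 1445–1448 (reprint: A. Montorsi (ed.), *The
Hubbard Model*, World Scientific, pp. 64–68), print after eq. (22), AS PRINTED (reprint p. 67, last
display, and p. 68, first line):

> The calculation of `μ₋` can be done in closed form for a half-filled band with the result
> `μ₋ - 2 = -4 ∫₀^∞ J₁(ω) dω / (ω [1 + exp(½ωU)])`
> `       = -4 Σ_{n=1}^∞ (-1)ⁿ [(1 + ¼ n²U²)^{1/2} - ½ nU].`                                  (23)
> It can be established from (22) and (23) that, indeed, `μ₊ > μ₋` for `U > 0`, and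
> `lim_{U → 0} μ_± = 0`.

Here `μ₊ = U - μ₋` is eq. (22). The first line of (23) is the definition of Lieb–Wu's `μ₋` used in
the tree (`Literature.MathematicalPhysics.QuantumLattice.liebWuMuMinus U := 2 - 4 ∫₀^∞ liebWuChargeGapIntegrand U`,
file `LiebWuBetheAnsatz.lean`; the integrand `liebWuChargeGapIntegrand U ω = J₁(ω)/(ω(1 + e^{ωU/2}))`
is `Literature.Analysis.FunctionSpaces.liebWuChargeGapIntegrand`, file `LiebWuIntegrals.lean`), and
`μ₊ > μ₋` is the theorem `liebWuChargeGap_pos_holds` (`LiebWuChargeGapProofs.lean`). This file proves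
the two remaining mathematical claims of the passage, which were not yet in the tree:

* **the series (second line of (23))**, `tendsto_sum_integral_liebWuChargeGapIntegrand`: for `U > 0`
  the partial sums `Σ_{n=1}^{N} (-1)^{n+1} [√(1 + n²U²/4) - nU/2]` converge to
  `∫₀^∞ J₁(ω)/(ω(1 + e^{ωU/2})) dω` (so `μ₋ - 2 = -4 · lim_N Σ_{n ≤ N} (-1)^{n+1}[…]`,
  `liebWu_muMinus_sub_two_series`); the series converges only conditionally (its terms are
  `≍ 1/(nU)`), so the statement is about the limit of the ORDERED partial sums, as printed; the
  absolutely convergent form obtained by pairing consecutive terms is `hasSum_integral_liebWuChargeGapIntegrand_pair`;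
* **`lim_{U → 0} μ_± = 0`**, `tendsto_liebWuMuMinus_zero` and `tendsto_liebWuMuPlus_zero` (indeed
  `U ↦ ∫₀^∞ J₁/(ω(1 + e^{ωU/2}))` is continuous on all of `ℝ`, `continuous_integral_liebWuChargeGapIntegrand`,
  with value `1/2` at `U = 0`, `integral_liebWuChargeGapIntegrand_zero`).

SIGN OF THE PRINTED SERIES. Read literally, the second line of (23) carries `(-1)ⁿ`; the correct sign
is `(-1)^{n+1}` (equivalently `+4 Σ (-1)ⁿ […]`): every term `√(1 + n²U²/4) - nU/2` is positive and
decreasing in `n`, so `Σ_{n ≥ 1} (-1)^{n+1}[…] > 0` (`integral_liebWuChargeGapIntegrand_pos`), and the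
right-hand side as printed converges to `2 - μ₋ > 0`, the NEGATIVE of the left-hand side `μ₋ - 2 < 0`
(`tendsto_printed_rhs_eq23`, `liebWuMuMinus_lt_two`). The same display, with the same sign, is
reproduced in Lieb–Wu, Physica A 321 (2003) 1, §7 (arXiv:cond-mat/0207529 p. 15, the unnumbered
display after (dmu0)), together with the expansion "`(1 + eˣ)⁻¹ = Σ_{n ≥ 1} (-1)ⁿ e^{-nx}`" of §6 from
which it is integrated term by term (the correct expansion, used in (rhosum) there, has `(-1)^{n+1}`).
The 1968 Erratum (Phys. Rev. Lett. 21 (1968) 192) has been requested (acq-10212) and not seen; the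
theorems below state the identity with the sign that makes it true and record the printed form.
Numerically (60-digit check, this seat): `U = 4`: `∫ = 0.16084088…`, `μ₋ = 1.35663649…`,
`μ₊ - μ₋ = 1.28672702…`.

## Proof (Lieb–Wu's: "expanding the denominator in the integrand and integrating term by term")

1. `integral_exp_neg_mul_besselJ_one_div`: the Lipschitz–Hankel integral
   `∫₀^∞ e^{-cω} J₁(ω) dω/ω = √(1 + c²) - c` for `c > 0` (Watson, *Bessel Functions*, §13.2 (7) with
   `ν = 1`, `b = 1`). Real-variable proof: Poisson's integral `J₁(ω)/ω = π⁻¹ ∫₀^π cos(ω cos θ) sin²θ dθ`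
   (`besselJ_one_div_eq_integral`), Fubini, `∫₀^∞ e^{-cω} cos(bω) dω = c/(c² + b²)`
   (`integral_exp_neg_mul_cos`), and `∫₀^π c dθ/(c² + cos²θ) = π/√(1 + c²)`
   (`integral_div_sq_add_cos_sq`, the case `s = 0` of `integral_pi_poissonCos`).
2. `tendsto_sum_integral_liebWuChargeGapIntegrand`: with `a = U/2` and `x = e^{-aω} ∈ (0, 1)`,
   `Σ_{n<N} (-1)ⁿ x^{n+1} → x/(1 + x) = 1/(1 + e^{aω})` with `|Σ_{n<N} (-1)ⁿ x^{n+1}| ≤ 2x`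
   (`tendsto_alternating_geom`, `abs_alternating_geom_le`), and `|J₁(ω)/ω| ≤ 1/2`; dominated convergence
   with the bound `e^{-aω}` exchanges limit and integral, and step 1 evaluates each term.
3. Pairing: `L(c) = √(1 + c²) - c` is strictly decreasing, so the pairs
   `L((2m+1)a) - L((2m+2)a)` are positive and sum (unconditionally) to the integral, which is
   therefore positive.
4. Continuity in `U` of `∫₀^∞ J₁/(ω(1 + e^{ωU/2}))` by dominated convergence with the bound `|J₁(ω)|/ω`
   (`integrableOn_besselJ_one_div`); the value `1/2` at `U = 0` is `liebWuChargeGap_zero_holds`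
   (`∫₀^∞ J₁/ω = 1`, Weber–Schafheitlin).

No named facts; all statements proved. Namespace `Literature.Analysis.FunctionSpaces` (directory rule).

## References

* E. H. Lieb, F. Y. Wu, Phys. Rev. Lett. 20 (1968) 1445, eqs. (21)–(23) and the sentence following
  (23) [LiebWuPRL1968]; Erratum ibid. 21 (1968) 192 (not seen).
* E. H. Lieb, F. Y. Wu, Physica A 321 (2003) 1–27 = arXiv:cond-mat/0207529, §7, boxed formula (mmu)
  for `μ₋(U)`, (mu0) `μ₋(0) = 0`, and the series display before (contourint) [LiebWuPhysicaA2003].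
* G. N. Watson, *A Treatise on the Theory of Bessel Functions*, 2nd ed. (1944), §13.2 eq. (7)
  [Watson1944].
-/

noncomputable section

open MeasureTheory Set Filter Real intervalIntegral
open scoped Topology

namespace Literature.Analysis.FunctionSpaces

open Literature.Analysis.SpecialFunctions

/-! ### Step 1: the Lipschitz–Hankel integral `∫₀^∞ e^{-cω} J₁(ω) dω/ω = √(1 + c²) - c` -/

/-- `∫₀^π c dθ/(c² + cos²θ) = π/√(1 + c²)` for `c > 0` (the case `s = 0` of the Poisson integral
`integral_pi_poissonCos`, the sign of the square root being fixed by positivity). [folklore] -/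
private theorem integral_div_sq_add_cos_sq {c : ℝ} (hc : 0 < c) :
    ∫ θ in (0 : ℝ)..π, c / (c ^ 2 + Real.cos θ ^ 2) = π / √(1 + c ^ 2) := by
  obtain ⟨D, hD2, hD0, hint⟩ := integral_pi_poissonCos (s := 0) hc
  have hpos := integral_pi_poissonCos_pos 0 hc
  simp only [Complex.ofReal_zero, zero_add, zero_sub, even_two, Even.neg_pow] at hD2 hint hpos
  set r : ℝ := √(1 + c ^ 2) with hr
  have hr0 : 0 < r := Real.sqrt_pos.2 (by positivity)
  have hr2 : r ^ 2 = 1 + c ^ 2 := Real.sq_sqrt (by positivity)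
  have hD2' : D ^ 2 = -((r : ℂ) ^ 2) := by
    rw [hD2, mul_pow, Complex.I_sq, ← Complex.ofReal_pow, ← Complex.ofReal_pow, hr2]
    push_cast
    ring
  have hfac : (D - r * Complex.I) * (D + r * Complex.I) = 0 := by
    have : (D - r * Complex.I) * (D + r * Complex.I) = D ^ 2 + (r : ℂ) ^ 2 := by
      ring_nf
      rw [Complex.I_sq]
      ring
    rw [this, hD2']
    ring
  rcases mul_eq_zero.1 hfac with h | h
  · have hD : D = r * Complex.I := sub_eq_zero.1 h
    have him : (D⁻¹).im = -r⁻¹ := by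
      rw [hD, Complex.inv_im]
      simp [Complex.normSq_apply]
      field_simp
    rw [hint, him]
    field_simp
  · have hD : D = -(r * Complex.I) := eq_neg_of_add_eq_zero_left h
    have him : (D⁻¹).im = r⁻¹ := by
      rw [hD, inv_neg, Complex.neg_im, Complex.inv_im]
      simp [Complex.normSq_apply]
      field_simp
    rw [hint, him] at hpos
    exfalso
    have : 0 < π * r⁻¹ := by positivity
    linarith

/-- `∫₀^π c sin²θ dθ/(c² + cos²θ) = π (√(1 + c²) - c)` for `c > 0`. [folklore] -/
private theorem integral_div_sq_add_cos_sq_mul_sin_sq {c : ℝ} (hc : 0 < c) :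
    ∫ θ in (0 : ℝ)..π, c / (c ^ 2 + Real.cos θ ^ 2) * Real.sin θ ^ 2 = π * (√(1 + c ^ 2) - c) := by
  have hden : ∀ θ : ℝ, 0 < c ^ 2 + Real.cos θ ^ 2 := fun θ => by positivity
  have h : ∀ θ : ℝ, c / (c ^ 2 + Real.cos θ ^ 2) * Real.sin θ ^ 2 =
      (1 + c ^ 2) * (c / (c ^ 2 + Real.cos θ ^ 2)) - c := by
    intro θ
    have hs : Real.sin θ ^ 2 = 1 - Real.cos θ ^ 2 := by
      have := Real.sin_sq_add_cos_sq θ; linarith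
    rw [hs]
    field_simp [(hden θ).ne']
    ring
  simp_rw [h]
  have hq : Continuous fun θ : ℝ => c / (c ^ 2 + Real.cos θ ^ 2) :=
    Continuous.div continuous_const (by fun_prop) fun θ => (hden θ).ne'
  rw [intervalIntegral.integral_sub ((hq.const_mul _).intervalIntegrable _ _)
      (continuous_const.intervalIntegrable _ _), intervalIntegral.integral_const_mul,
    integral_div_sq_add_cos_sq hc, intervalIntegral.integral_const, sub_zero, smul_eq_mul]
  have hr0 : 0 < √(1 + c ^ 2) := Real.sqrt_pos.2 (by positivity)
  have hdiv : (1 + c ^ 2) / √(1 + c ^ 2) = √(1 + c ^ 2) := Real.div_sqrt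
  calc (1 + c ^ 2) * (π / √(1 + c ^ 2)) - π * c = π * ((1 + c ^ 2) / √(1 + c ^ 2)) - π * c := by ring
    _ = π * (√(1 + c ^ 2) - c) := by rw [hdiv]; ring

/-- `|J₁(ω)/ω| ≤ 1/2` for every real `ω` (from `|J₁(x)| ≤ |x|/2`; at `ω = 0` the left side is `0`).
[folklore] -/
private theorem abs_besselJ_one_div_le (ω : ℝ) : |besselJ 1 ω / ω| ≤ 1 / 2 := by
  rcases eq_or_ne ω 0 with h | h
  · simp [h]
  · rw [abs_div, div_le_iff₀ (abs_pos.2 h)]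
    have := abs_besselJ_one_le_half_mul_abs ω
    linarith

/-- Integrability of `e^{-cω} J₁(ω)/ω` on `(0, ∞)` for `c > 0`. [folklore] -/
private theorem integrableOn_exp_neg_mul_besselJ_one_div {c : ℝ} (hc : 0 < c) :
    IntegrableOn (fun ω => Real.exp (-(c * ω)) * (besselJ 1 ω / ω)) (Ioi 0) := by
  have hmeas : Measurable fun ω : ℝ => Real.exp (-(c * ω)) * (besselJ 1 ω / ω) :=
    (by fun_prop : Measurable fun ω : ℝ => Real.exp (-(c * ω))).mul
      ((continuous_besselJ_holds 1).measurable.div measurable_id)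
  refine Integrable.mono' (exp_neg_integrableOn_Ioi 0 hc) hmeas.aestronglyMeasurable
    (Eventually.of_forall fun ω => ?_)
  rw [Real.norm_eq_abs, abs_mul, Real.abs_exp, neg_mul]
  have h1 := abs_besselJ_one_div_le ω
  have h0 := Real.exp_pos (-(c * ω))
  calc Real.exp (-(c * ω)) * |besselJ 1 ω / ω| ≤ Real.exp (-(c * ω)) * (1 / 2) := by gcongr
    _ ≤ Real.exp (-(c * ω)) := by linarith

/-- **The Lipschitz–Hankel integral** `∫₀^∞ e^{-cω} J₁(ω) dω/ω = √(1 + c²) - c` for `c > 0`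
(Watson, §13.2 eq. (7), `ν = 1`, `b = 1`); Lieb–Wu's "integrating term by term" in eq. (23) is this
formula with `c = nU/2`. Proof: Poisson's integral for `J₁`, Fubini, and the Laplace transform of the
cosine. [cite: Watson1944, §13.2 eq. (7)] -/
theorem integral_exp_neg_mul_besselJ_one_div {c : ℝ} (hc : 0 < c) :
    ∫ ω in Ioi (0 : ℝ), Real.exp (-(c * ω)) * (besselJ 1 ω / ω) = √(1 + c ^ 2) - c := by
  -- the integrand on `[0, π] × (0, ∞)`
  set F : ℝ → ℝ → ℝ := fun θ ω => Real.exp (-(c * ω)) * Real.cos (ω * Real.cos θ) * Real.sin θ ^ 2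
    with hF
  -- Step 1: insert Poisson's integral and swap
  have hstep1 : ∀ ω ∈ Ioi (0 : ℝ), Real.exp (-(c * ω)) * (besselJ 1 ω / ω) =
      π⁻¹ * ∫ θ in (0 : ℝ)..π, F θ ω := by
    intro ω hω
    rw [besselJ_one_div_eq_integral ω (ne_of_gt hω), mul_left_comm,
      ← intervalIntegral.integral_const_mul]
    congr 1
    refine intervalIntegral.integral_congr fun θ _ => ?_
    simp only [hF]
    ring
  rw [setIntegral_congr_fun measurableSet_Ioi hstep1, MeasureTheory.integral_const_mul]
  -- integrability on the product
  have hint : Integrable (Function.uncurry F)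
      ((volume.restrict (Set.uIoc 0 π)).prod (volume.restrict (Ioi (0 : ℝ)))) := by
    haveI : IsFiniteMeasure (volume.restrict (Set.uIoc 0 π)) := by
      refine isFiniteMeasure_restrict.2 ?_
      simp [Set.uIoc, Real.volume_Ioc]
    have hg : Integrable (fun z : ℝ × ℝ => (1 : ℝ) * Real.exp (-c * z.2))
        ((volume.restrict (Set.uIoc 0 π)).prod (volume.restrict (Ioi (0 : ℝ)))) :=
      Integrable.mul_prod (integrable_const 1) (exp_neg_integrableOn_Ioi 0 hc)
    refine hg.mono' ?_ (Eventually.of_forall fun z => ?_)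
    · exact (by fun_prop : Continuous (Function.uncurry F)).aestronglyMeasurable
    · rcases z with ⟨θ, ω⟩
      simp only [Function.uncurry_apply_pair, hF, Real.norm_eq_abs, one_mul, neg_mul]
      rw [abs_mul, abs_mul, Real.abs_exp]
      have h1 := Real.abs_cos_le_one (ω * Real.cos θ)
      have h2 : |Real.sin θ ^ 2| ≤ 1 := by
        rw [abs_of_nonneg (sq_nonneg _), sq_le_one_iff_abs_le_one]
        exact Real.abs_sin_le_one θ
      have h0 := Real.exp_pos (-(c * ω))
      calc Real.exp (-(c * ω)) * |Real.cos (ω * Real.cos θ)| * |Real.sin θ ^ 2|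
          ≤ Real.exp (-(c * ω)) * 1 * 1 := by gcongr
        _ = Real.exp (-(c * ω)) := by ring
  rw [← MeasureTheory.intervalIntegral_integral_swap hint]
  -- Step 2: the inner Laplace transforms
  have hinner : ∀ θ, ∫ ω in Ioi (0 : ℝ), F θ ω = c / (c ^ 2 + Real.cos θ ^ 2) * Real.sin θ ^ 2 := by
    intro θ
    have e : (fun ω => F θ ω) =
        fun ω => Real.sin θ ^ 2 * (Real.exp (-(c * ω)) * Real.cos (Real.cos θ * ω)) := by
      funext ω
      simp only [hF]
      rw [mul_comm (Real.cos θ) ω]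
      ring
    rw [e, MeasureTheory.integral_const_mul, integral_exp_neg_mul_cos hc (Real.cos θ)]
    ring
  simp_rw [hinner]
  rw [integral_div_sq_add_cos_sq_mul_sin_sq hc]
  field_simp

/-! ### Step 2: the alternating series of eq. (23) -/

/-- **Lieb–Wu 1968, eq. (23), second line (the alternating series)**, for the integral
`I(U) = ∫₀^∞ J₁(ω) dω/(ω[1 + exp(½ωU)])` of the first line: for `U > 0` the ORDERED partial sums
`Σ_{n=1}^{N} (-1)^{n+1} [(1 + ¼n²U²)^{1/2} - ½nU]` converge to `I(U)` (here indexed by `n + 1`,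
`n < N`). Printed with `(-1)ⁿ` in place of `(-1)^{n+1}` (reprint p. 68 line 1; likewise Physica A 321
(2003) §7); see the module docstring and `tendsto_printed_rhs_eq23`. Proof: expand
`1/(1 + e^{ωU/2}) = Σ_{n ≥ 1} (-1)^{n+1} e^{-nωU/2}` (partial sums bounded by `2e^{-ωU/2}`), dominated
convergence, and the Lipschitz–Hankel integral `integral_exp_neg_mul_besselJ_one_div` with `c = nU/2`.
[cite: LiebWuPRL1968, eq. (23)] -/
theorem tendsto_sum_integral_liebWuChargeGapIntegrand {U : ℝ} (hU : 0 < U) :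
    Tendsto (fun N => ∑ n ∈ Finset.range N,
        (-1 : ℝ) ^ n * (√(1 + ((n + 1) * (U / 2)) ^ 2) - (n + 1) * (U / 2))) atTop
      (𝓝 (∫ ω in Ioi (0 : ℝ), liebWuChargeGapIntegrand U ω)) := by
  set a : ℝ := U / 2 with ha_def
  have ha : 0 < a := by positivity
  have hJm : Measurable fun ω : ℝ => besselJ 1 ω / ω :=
    (continuous_besselJ_holds 1).measurable.div measurable_id
  -- the partial sums of the integrands
  set F : ℕ → ℝ → ℝ := fun N ω => ∑ n ∈ Finset.range N,
    (-1 : ℝ) ^ n * (Real.exp (-((n + 1) * a * ω)) * (besselJ 1 ω / ω)) with hF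
  have hFeq : ∀ N ω, F N ω = besselJ 1 ω / ω *
      ∑ n ∈ Finset.range N, (-1 : ℝ) ^ n * Real.exp (-(a * ω)) ^ (n + 1) := by
    intro N ω
    simp only [hF, Finset.mul_sum]
    refine Finset.sum_congr rfl fun n _ => ?_
    have : Real.exp (-((n + 1) * a * ω)) = Real.exp (-(a * ω)) ^ (n + 1) := by
      rw [← Real.exp_nat_mul]
      congr 1
      push_cast
      ring
    rw [this]
    ring
  -- the integrals of the partial sums
  have hint : ∀ N, ∫ ω in Ioi (0 : ℝ), F N ω = ∑ n ∈ Finset.range N,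
      (-1 : ℝ) ^ n * (√(1 + ((n + 1) * a) ^ 2) - (n + 1) * a) := by
    intro N
    simp only [hF]
    rw [MeasureTheory.integral_finsetSum]
    · refine Finset.sum_congr rfl fun n _ => ?_
      rw [MeasureTheory.integral_const_mul,
        integral_exp_neg_mul_besselJ_one_div (by positivity : (0 : ℝ) < (n + 1) * a)]
    · intro n _
      exact (integrableOn_exp_neg_mul_besselJ_one_div (by positivity : (0 : ℝ) < (n + 1) * a)).const_mul _
  have hlim := tendsto_integral_of_dominated_convergence (fun ω => Real.exp (-(a * ω)))
    (μ := volume.restrict (Ioi (0 : ℝ))) (F := F)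
    (f := fun ω => liebWuChargeGapIntegrand U ω) ?_ ?_ ?_ ?_
  · simp_rw [hint] at hlim
    exact hlim
  · intro N
    have hFN : F N = fun ω => besselJ 1 ω / ω *
        ∑ n ∈ Finset.range N, (-1 : ℝ) ^ n * Real.exp (-(a * ω)) ^ (n + 1) := funext (hFeq N)
    rw [hFN]
    exact (hJm.mul (by fun_prop : Continuous fun ω : ℝ =>
      ∑ n ∈ Finset.range N, (-1 : ℝ) ^ n * Real.exp (-(a * ω)) ^ (n + 1)).measurable).aestronglyMeasurable
  · exact (exp_neg_integrableOn_Ioi 0 ha).congr_fun (fun ω _ => by simp only [neg_mul]) measurableSet_Ioi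
  · intro N
    filter_upwards [ae_restrict_mem measurableSet_Ioi] with ω hω
    have hω : (0 : ℝ) < ω := hω
    set x := Real.exp (-(a * ω)) with hx
    have hx0 : 0 ≤ x := (Real.exp_pos _).le
    have hx1 : x ≤ 1 := by
      rw [hx, Real.exp_le_one_iff]
      have := mul_pos ha hω
      linarith
    rw [hFeq, Real.norm_eq_abs, abs_mul]
    have h1 := abs_besselJ_one_div_le ω
    have h3 := abs_alternating_geom_le hx0 hx1 N
    calc |besselJ 1 ω / ω| * |∑ n ∈ Finset.range N, (-1 : ℝ) ^ n * x ^ (n + 1)|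
        ≤ (1 / 2) * (2 * x) := by gcongr
      _ = x := by ring
  · filter_upwards [ae_restrict_mem measurableSet_Ioi] with ω hω
    have hω : (0 : ℝ) < ω := hω
    set x := Real.exp (-(a * ω)) with hx
    have hx0 : 0 ≤ x := (Real.exp_pos _).le
    have hx1 : x < 1 := by
      rw [hx, Real.exp_lt_one_iff]
      have := mul_pos ha hω
      linarith
    have hval : x / (1 + x) = 1 / (1 + Real.exp (ω * U / 2)) := by
      have hexp : Real.exp (ω * U / 2) = Real.exp (a * ω) := by rw [ha_def]; ring_nf
      have hxe : x * Real.exp (a * ω) = 1 := by rw [hx, ← Real.exp_add]; simp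
      have h1x : 0 < 1 + x := by linarith
      rw [hexp]
      field_simp
      linarith
    simp_rw [hFeq]
    have := (tendsto_alternating_geom hx0 hx1).const_mul (besselJ 1 ω / ω)
    rw [hval] at this
    convert this using 2
    rw [liebWuChargeGapIntegrand]
    have hden : 0 < 1 + Real.exp (ω * U / 2) := by positivity
    field_simp

/-- **Eq. (23) for `μ₋ - 2`.** With `μ₋(U) = 2 - 4 ∫₀^∞ J₁/(ω(1 + e^{ωU/2}))` (the first line of (23);
this is `Literature.MathematicalPhysics.QuantumLattice.liebWuMuMinus U` by `rfl`), for `U > 0`: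
`μ₋ - 2 = lim_N ( -4 Σ_{n=1}^{N} (-1)^{n+1} [(1 + ¼n²U²)^{1/2} - ½nU] )` (indexed by `n + 1`).
[cite: LiebWuPRL1968, eq. (23)] -/
theorem liebWu_muMinus_sub_two_series {U : ℝ} (hU : 0 < U) :
    Tendsto (fun N => -4 * ∑ n ∈ Finset.range N,
        (-1 : ℝ) ^ n * (√(1 + (n + 1) ^ 2 * U ^ 2 / 4) - (n + 1) * U / 2)) atTop
      (𝓝 ((2 - 4 * ∫ ω in Ioi (0 : ℝ), liebWuChargeGapIntegrand U ω) - 2)) := by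
  have h := (tendsto_sum_integral_liebWuChargeGapIntegrand hU).const_mul (-4)
  have e : (2 - 4 * ∫ ω in Ioi (0 : ℝ), liebWuChargeGapIntegrand U ω) - 2 =
      -4 * ∫ ω in Ioi (0 : ℝ), liebWuChargeGapIntegrand U ω := by ring
  rw [e]
  refine h.congr fun N => ?_
  congr 1
  refine Finset.sum_congr rfl fun n _ => ?_
  congr 2
  · congr 1; ring
  · ring

/-! ### Step 3: pairing — absolute convergence, positivity, and the printed sign -/

/-- The Lipschitz–Hankel value `L(c) = √(1 + c²) - c` is strictly decreasing in `c`. [folklore] -/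
private theorem sqrt_one_add_sq_sub_strictAnti : StrictAnti fun c : ℝ => √(1 + c ^ 2) - c := by
  intro c₁ c₂ h
  simp only
  set A := √(1 + c₁ ^ 2) with hA_def
  set B := √(1 + c₂ ^ 2) with hB_def
  have hA : A ^ 2 = 1 + c₁ ^ 2 := Real.sq_sqrt (by positivity)
  have hB : B ^ 2 = 1 + c₂ ^ 2 := Real.sq_sqrt (by positivity)
  have hA0 : 0 ≤ A := Real.sqrt_nonneg _
  have hB0 : 0 ≤ B := Real.sqrt_nonneg _
  have hA1 : c₁ < A := by
    by_cases hc : 0 ≤ c₁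
    · exact (Real.lt_sqrt hc).2 (by linarith)
    · exact (lt_of_not_ge hc).trans_le hA0
  have hB1 : c₂ < B := by
    by_cases hc : 0 ≤ c₂
    · exact (Real.lt_sqrt hc).2 (by linarith)
    · exact (lt_of_not_ge hc).trans_le hB0
  have hAB : 0 < A + B - c₁ - c₂ := by linarith
  by_contra hle
  push Not at hle
  -- `hle : A - c₁ ≤ B - c₂`, i.e. `c₂ - c₁ ≤ B - A`; multiply by `A + B > c₁ + c₂ > ...`
  have h1 : (c₂ - c₁) * (A + B) ≤ (B - A) * (A + B) :=
    mul_le_mul_of_nonneg_right (by linarith) (by linarith)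
  have h2 : (c₂ - c₁) * (c₁ + c₂) < (c₂ - c₁) * (A + B) :=
    mul_lt_mul_of_pos_left (by linarith) (sub_pos.2 h)
  nlinarith

/-- **The paired series.** For `U > 0`, with `L(c) = √(1 + c²) - c` and `a = U/2`, the pairs
`L((2m+1)a) - L((2m+2)a) > 0` of consecutive terms of the series (23) sum — unconditionally — to
`∫₀^∞ J₁(ω)/(ω(1 + e^{ωU/2})) dω`. [cite: LiebWuPRL1968, eq. (23)] -/
theorem hasSum_integral_liebWuChargeGapIntegrand_pair {U : ℝ} (hU : 0 < U) :
    HasSum (fun m : ℕ => (√(1 + ((2 * m + 1) * (U / 2)) ^ 2) - (2 * m + 1) * (U / 2)) -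
        (√(1 + ((2 * m + 2) * (U / 2)) ^ 2) - (2 * m + 2) * (U / 2)))
      (∫ ω in Ioi (0 : ℝ), liebWuChargeGapIntegrand U ω) := by
  set a : ℝ := U / 2 with ha_def
  have ha : 0 < a := by positivity
  set L : ℝ → ℝ := fun c => √(1 + c ^ 2) - c with hL
  have hpair_nonneg : ∀ m : ℕ, 0 ≤ L ((2 * m + 1) * a) - L ((2 * m + 2) * a) := fun m =>
    sub_nonneg.2 (sqrt_one_add_sq_sub_strictAnti (by nlinarith)).le
  show HasSum (fun m : ℕ => L ((2 * m + 1) * a) - L ((2 * m + 2) * a)) _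
  rw [hasSum_iff_tendsto_nat_of_nonneg hpair_nonneg]
  have h := tendsto_sum_integral_liebWuChargeGapIntegrand hU
  have h2 : Tendsto (fun M : ℕ => 2 * M) atTop atTop :=
    tendsto_atTop_mono (fun M => by show M ≤ 2 * M; omega) tendsto_id
  have hcomp := h.comp h2
  refine hcomp.congr fun M => ?_
  simp only [Function.comp]
  -- pairing consecutive terms
  induction M with
  | zero => simp
  | succ M ih =>
    rw [show 2 * (M + 1) = 2 * M + 1 + 1 by ring, Finset.sum_range_succ, Finset.sum_range_succ, ih,
      Finset.sum_range_succ]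
    have e1 : (-1 : ℝ) ^ (2 * M) = 1 := by rw [pow_mul]; simp
    have e2 : (-1 : ℝ) ^ (2 * M + 1) = -1 := by rw [pow_succ, e1]; simp
    have c1 : ((2 * M : ℕ) : ℝ) + 1 = 2 * (M : ℝ) + 1 := by push_cast; ring
    have c2 : ((2 * M + 1 : ℕ) : ℝ) + 1 = 2 * (M : ℝ) + 2 := by push_cast; ring
    rw [e1, e2, c1, c2]
    simp only [hL]
    ring

/-- **Positivity of the integral in (23)**: `∫₀^∞ J₁(ω)/(ω(1 + e^{ωU/2})) dω > 0` for every `U > 0`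
(the paired terms of the series are positive). Equivalently `μ₋(U) < 2`. [cite: LiebWuPRL1968, eq. (23)] -/
theorem integral_liebWuChargeGapIntegrand_pos {U : ℝ} (hU : 0 < U) :
    0 < ∫ ω in Ioi (0 : ℝ), liebWuChargeGapIntegrand U ω := by
  have h := hasSum_integral_liebWuChargeGapIntegrand_pair hU
  have hnonneg : ∀ m : ℕ, 0 ≤ (√(1 + ((2 * m + 1) * (U / 2)) ^ 2) - (2 * m + 1) * (U / 2)) -
      (√(1 + ((2 * m + 2) * (U / 2)) ^ 2) - (2 * m + 2) * (U / 2)) := fun m =>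
    sub_nonneg.2 (sqrt_one_add_sq_sub_strictAnti (by nlinarith)).le
  have h0 : 0 < (√(1 + ((2 * (0 : ℕ) + 1) * (U / 2)) ^ 2) - (2 * (0 : ℕ) + 1) * (U / 2)) -
      (√(1 + ((2 * (0 : ℕ) + 2) * (U / 2)) ^ 2) - (2 * (0 : ℕ) + 2) * (U / 2)) :=
    sub_pos.2 (sqrt_one_add_sq_sub_strictAnti (by nlinarith))
  calc (0 : ℝ) < ∑ m ∈ Finset.range 1, ((√(1 + ((2 * m + 1) * (U / 2)) ^ 2) - (2 * m + 1) * (U / 2)) -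
      (√(1 + ((2 * m + 2) * (U / 2)) ^ 2) - (2 * m + 2) * (U / 2))) := by simpa using h0
    _ ≤ ∫ ω in Ioi (0 : ℝ), liebWuChargeGapIntegrand U ω :=
      sum_le_hasSum (Finset.range 1) (fun m _ => hnonneg m) h

/-- `μ₋(U) < 2` for every `U > 0` (`μ₋ = 2 - 4∫₀^∞ J₁/(ω(1 + e^{ωU/2}))` with a positive integral).
[cite: LiebWuPRL1968, eq. (23)] -/
theorem liebWuMuMinus_lt_two {U : ℝ} (hU : 0 < U) :
    2 - 4 * ∫ ω in Ioi (0 : ℝ), liebWuChargeGapIntegrand U ω < 2 := by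
  have := integral_liebWuChargeGapIntegrand_pos hU
  linarith

/-- **The printed sign of (23).** Read literally — `-4 Σ_{n=1}^∞ (-1)ⁿ [(1 + ¼n²U²)^{1/2} - ½nU]`,
reprint p. 68 line 1 (and Physica A 321 (2003) §7) — the right-hand side of (23) converges to
`2 - μ₋(U)`, the negative of the left-hand side `μ₋(U) - 2`; since `μ₋ < 2` (`liebWuMuMinus_lt_two`)
the two differ for every `U > 0`, i.e. the printed exponent `n` stands for `n + 1`
(`liebWu_muMinus_sub_two_series`). [cite: LiebWuPRL1968, eq. (23)] -/
theorem tendsto_printed_rhs_eq23 {U : ℝ} (hU : 0 < U) :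
    Tendsto (fun N => -4 * ∑ n ∈ Finset.range N,
        (-1 : ℝ) ^ (n + 1) * (√(1 + (n + 1) ^ 2 * U ^ 2 / 4) - (n + 1) * U / 2)) atTop
      (𝓝 (2 - (2 - 4 * ∫ ω in Ioi (0 : ℝ), liebWuChargeGapIntegrand U ω))) := by
  have h := (liebWu_muMinus_sub_two_series hU).neg
  have e : -((2 - 4 * ∫ ω in Ioi (0 : ℝ), liebWuChargeGapIntegrand U ω) - 2) =
      2 - (2 - 4 * ∫ ω in Ioi (0 : ℝ), liebWuChargeGapIntegrand U ω) := by ring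
  rw [e] at h
  refine h.congr fun N => ?_
  rw [← mul_neg, ← Finset.sum_neg_distrib]
  congr 1
  refine Finset.sum_congr rfl fun n _ => ?_
  rw [pow_succ]
  ring

/-! ### Step 4: continuity in `U` and `lim_{U → 0} μ_± = 0` -/

/-- The integral `U ↦ ∫₀^∞ J₁(ω)/(ω(1 + e^{ωU/2})) dω` is continuous on `ℝ` (dominated convergence with
the bound `|J₁(ω)|/ω`, integrable on `(0, ∞)`). [folklore] -/
private theorem continuous_integral_liebWuChargeGapIntegrand :
    Continuous fun U : ℝ => ∫ ω in Ioi (0 : ℝ), liebWuChargeGapIntegrand U ω := by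
  refine continuous_of_dominated (bound := fun ω => |besselJ 1 ω / ω|) ?_ ?_ ?_ ?_
  · intro U
    exact (continuousOn_liebWuChargeGapIntegrand U).aestronglyMeasurable measurableSet_Ioi
  · intro U
    filter_upwards [ae_restrict_mem measurableSet_Ioi] with ω hω
    have hω : (0 : ℝ) < ω := hω
    rw [Real.norm_eq_abs, abs_div, abs_of_pos hω]
    exact abs_liebWuChargeGapIntegrand_le_div hω
  · exact integrableOn_besselJ_one_div.abs
  · filter_upwards [ae_restrict_mem measurableSet_Ioi] with ω hω
    have hω : (0 : ℝ) < ω := hω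
    have : (fun U : ℝ => liebWuChargeGapIntegrand U ω) =
        fun U => besselJ 1 ω / (ω * (1 + Real.exp (ω * U / 2))) := by
      funext U; rfl
    rw [this]
    exact Continuous.div continuous_const (by fun_prop) fun U => by positivity

/-- At `U = 0` the integral of (23) is `∫₀^∞ J₁(ω)/(2ω) dω = 1/2` (Weber–Schafheitlin
`∫₀^∞ J₁/ω = 1`; this is `μ₋(0) = 0`, Physica A (2003) §7 (mu0)). [cite: LiebWuPhysicaA2003, §7 eq. (mu0)] -/
theorem integral_liebWuChargeGapIntegrand_zero :
    ∫ ω in Ioi (0 : ℝ), liebWuChargeGapIntegrand 0 ω = 1 / 2 := by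
  have h := liebWuChargeGap_zero_holds
  rw [liebWuChargeGap_zero, liebWuChargeGap] at h
  linarith

/-- **Lieb–Wu 1968, after eq. (23): `lim_{U → 0} μ₋ = 0`.** With
`μ₋(U) = 2 - 4 ∫₀^∞ J₁/(ω(1 + e^{ωU/2}))` (= `liebWuMuMinus U`), `μ₋(U) → 0` as `U → 0⁺` (indeed as
`U → 0`, by continuity and `μ₋(0) = 0`). [cite: LiebWuPRL1968, sentence after eq. (23)] -/
theorem tendsto_liebWuMuMinus_zero :
    Tendsto (fun U : ℝ => 2 - 4 * ∫ ω in Ioi (0 : ℝ), liebWuChargeGapIntegrand U ω)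
      (𝓝[>] 0) (𝓝 0) := by
  have hc : Continuous fun U : ℝ => 2 - 4 * ∫ ω in Ioi (0 : ℝ), liebWuChargeGapIntegrand U ω :=
    continuous_const.sub (continuous_const.mul continuous_integral_liebWuChargeGapIntegrand)
  have h0 : (2 : ℝ) - 4 * ∫ ω in Ioi (0 : ℝ), liebWuChargeGapIntegrand 0 ω = 0 := by
    rw [integral_liebWuChargeGapIntegrand_zero]; norm_num
  have := (hc.tendsto 0).mono_left (nhdsWithin_le_nhds (s := Ioi (0 : ℝ)))
  rwa [h0] at this

/-- **Lieb–Wu 1968, after eq. (23): `lim_{U → 0} μ₊ = 0`**, where `μ₊ = U - μ₋` (eq. (22),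
half-filled band). [cite: LiebWuPRL1968, eqs. (22)–(23) and the sentence after (23)] -/
theorem tendsto_liebWuMuPlus_zero :
    Tendsto (fun U : ℝ => U - (2 - 4 * ∫ ω in Ioi (0 : ℝ), liebWuChargeGapIntegrand U ω))
      (𝓝[>] 0) (𝓝 0) := by
  have hU : Tendsto (fun U : ℝ => U) (𝓝[>] 0) (𝓝 0) :=
    (continuous_id.tendsto 0).mono_left nhdsWithin_le_nhds
  simpa using hU.sub tendsto_liebWuMuMinus_zero

/-- **The passage after (23), assembled**: for `U > 0`, `μ₊ > μ₋` (this is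
`liebWuChargeGap_pos_holds`: `μ₊ - μ₋ = U - 2μ₋ = liebWuChargeGap U > 0`), together with
`lim_{U → 0⁺} μ_± = 0`. [cite: LiebWuPRL1968, sentence after eq. (23)] -/
theorem liebWu1968_after_eq23 :
    (∀ {U : ℝ}, 0 < U →
      (2 - 4 * ∫ ω in Ioi (0 : ℝ), liebWuChargeGapIntegrand U ω) <
        U - (2 - 4 * ∫ ω in Ioi (0 : ℝ), liebWuChargeGapIntegrand U ω)) ∧
    Tendsto (fun U : ℝ => 2 - 4 * ∫ ω in Ioi (0 : ℝ), liebWuChargeGapIntegrand U ω) (𝓝[>] 0) (𝓝 0) ∧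
    Tendsto (fun U : ℝ => U - (2 - 4 * ∫ ω in Ioi (0 : ℝ), liebWuChargeGapIntegrand U ω))
      (𝓝[>] 0) (𝓝 0) := by
  refine ⟨fun {U} hU => ?_, tendsto_liebWuMuMinus_zero, tendsto_liebWuMuPlus_zero⟩
  have h := liebWuChargeGap_pos_holds hU
  rw [liebWuChargeGap] at h
  linarith

end Literature.Analysis.FunctionSpaces
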